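import Summits.BirchSwinnertonDyer.Rank1Residual.F1Sign2.CopyAlignmentAtTwo
import Summits.BirchSwinnertonDyer.BirchSwinnertonDyer.Theorems.ResidualThetaTransportAtTwoThetaLayerLambdaCongruenceAtTwoHeckeAdjointTranspose
import Literature.NumberTheory.EllipticCurves.ModularSymbolsEichlerShimuraHoldsProofs
import Literature.NumberTheory.EllipticCurves.ModularJacobianMultiplicityOneCosocleProofs
import Mathlib.LinearAlgebra.Dual.Lemmas
import HarnessLib

/-!
# Crux C1 `MainConjectureTransportAlignedAtTwo` (stmt-BirchSwinnertonDyer-22296), line `birth`, residual (R2) `stub_lamLawKilford` (Kilford stratum):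
# RANK TWO — the isotypic sublattice `Λ[I_f] ⊆ Λ = H₁(X₀(N);ℤ)` of the newform of an elliptic curve has `ℤ`-rank AT MOST `2`
# (multiplicity one for the newform's eigencharacter, in the kernel; width seat att-p4 g16; `--supports 22296`)

THEOREMS ONLY (no `def`, no `sorry`, no named fact); UNCONDITIONAL. BSD is not proved by this; C1 is not closed by this;
`stub_lamLawKilford` is NOT discharged by this.

WHY. The COPY → KERNEL bridge for (R2) at equal conductors (att-p3 g16 `…KilfordCopyKernelAlgebra` p680730 ff.; this seat's
`…KilfordCopyCommonKernel` p680513) consumes ONE input beyond the cell's named conjectures `F1Sign2.CopyAlignmentAtTwo` /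
`F1Sign2.MultiplicityTwoOnStratumAtTwo`: **RANK2** — «`rank_ℤ Λ[I_f] = 2` for the newform `f` of an elliptic curve»
(`Λ[I_f] = {x ∈ Λ : I_f · x = 0}`, `I_f = heckeAnnihilator f`; Shimura: `dim A_f = [K_f : ℚ] = 1`; Darmon–Diamond–Taylor §1.7;
Cremona §2.8), which att-p3 g16 carries INLINE and asked -ty to type. This file PROVES the load-bearing half `rank ≤ 2` from tree theorems:

* §1 `card_le_finrank_of_linearIndependent_int` (linear algebra on `ℚⁿ ⊆ ℝⁿ`): `ℤ`-linearly independent RATIONAL vectors lying in a real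
  subspace `D` number at most `dim_ℝ D` (a `ℚ`-complement inside `ℚⁿ` + the tree's `PeriodRank.finrank_real_span_le_finrank_rat`).
* §2–§3 **`card_le_two_of_linearIndependent_of_isotypic`**: for `f` with `IsNewformOf W f`, every `ℤ`-linearly independent family in
  `Λ = periodHomologyHecke N` killed by `I_f` has at most TWO members. Mechanism: the Hecke-self-adjoint PERFECT pairing `B` on `Λ` (tree theorem
  `…ThetaLayerLambdaCongruenceAtTwo.ip_of_crossingPairing_flagSides`) sends `x ∈ Λ[I_f]` to the functional `B(x, ·)`, which kills `I_f·Λ`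
  (`B(x, t y) = B(t x, y) = 0`); extended `ℝ`-linearly to `V = S₂(Γ₀(N))^∨` through the Eichler–Shimura basis of `Λ` (tree theorem
  `periodHomology_eq_span_basis_holds`: `Λ = ℤφ₁ ⊕ ⋯ ⊕ ℤφₙ`, `(φᵢ)` a real basis of `V`), it kills `U = ∑_p range (T_p − a_p)^∨`, whose real
  codimension is `2 · dim_ℂ ⋂_p ker(T_p − a_p) = 2` (multiplicity one `IsNewform0.mem_span_of_forall_heckeT_eq_smul` + the tree's
  `PeriodRank.finrank_dual_quotient_iSup_range_dualMap`); `x ↦ B(x, ·)` is injective and integral in the dual basis, so §1 applies. (The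
  self-adjoint perfect pairing is what converts the KERNEL-type lattice `Λ[I_f]` into an annihilator of RANGES — for a non-semisimple Hecke action
  at non-squarefree `N` the two counts differ a priori.)
* §4 corollary in the consumers' currency: `finrank_isotypic_le_two` — `Module.finrank ℤ Λ[I_f] ≤ 2` for
  `Λ[I_f] = (Submodule.torsionBySet 𝕋_ℤ Λ I_f).restrictScalars ℤ`, `Λ = periodHomologyHecke N`, `I_f = F1Sign2.heckeAnnihilator f`.
The opposite inequality `rank ≥ 2` (two independent periods) is att-p3 g16's and is not repeated here.

References: Darmon–Diamond–Taylor 1995 §1.3, §1.6 Lemma 1.38, §1.7 [DarmonDiamondTaylor1995]; Cremona 1997 §2.8, §2.10 [CremonaAlgorithms1997];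
Shimura 1971 Thm. 7.14 [Shimura1971]; Atkin–Lehner 1970 Thm. 5 [AtkinLehner1970]; Merel 1995 §1.2–2.3 [Merel1995Homologie].
-/

noncomputable section

-- justification: the `Summit.BirchSwinnertonDyer.BirchSwinnertonDyer.…` path repeats a component (route-file convention)
set_option linter.dupNamespace false
set_option autoImplicit false

open scoped MatrixGroups ModularForm NumberField Classical
open CongruenceSubgroup Complex Module Submodule
open Literature.NumberTheory.EllipticCurves Literature.NumberTheory.EllipticCurves.ModularForms
open Summit.BirchSwinnertonDyer.Rank1Residual.F1Sign2
open Summit.BirchSwinnertonDyer.BirchSwinnertonDyer.Theorems.ThetaLayerLambdaCongruenceAtTwo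

namespace Summit.BirchSwinnertonDyer.BirchSwinnertonDyer.Theorems.AlignedTransportAtTwoKilfordCopyRankTwo

/-! ## §1 Linear algebra: independent rational vectors inside a real subspace -/

/-- **`ℤ`-independent rational vectors in a real subspace `D ⊆ ℝⁿ` number at most `dim_ℝ D`.** If `u₁,…,u_k ∈ ℚⁿ ⊆ ℝⁿ` are `ℤ`-linearly
independent and lie in `D`, then `k ≤ dim_ℝ D`: they are `ℚ`-independent, and for the `ℚ`-space `U = ℚu₁ + ⋯ + ℚu_k` with a `ℚ`-complement `U'`
in `ℚⁿ` one has `n ≤ dim_ℝ(ℝU) + dim_ℝ(ℝU') ≤ dim_ℝ(ℝU) + dim_ℚ U' = dim_ℝ(ℝU) + n − k`. [folklore] -/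
theorem card_le_finrank_of_linearIndependent_int {n k : ℕ} (u : Fin k → (Fin n → ℝ))
    (hu : ∀ j, u j ∈ PeriodRank.ratVectors n) (hli : LinearIndependent ℤ u)
    (D : Submodule ℝ (Fin n → ℝ)) (hD : ∀ j, u j ∈ D) : k ≤ finrank ℝ D := by
  have hQ : LinearIndependent ℚ u := (LinearIndependent.iff_fractionRing ℤ ℚ).mp hli
  set W : Submodule ℚ (Fin n → ℝ) := PeriodRank.ratVectors n with hW
  let Uq : Submodule ℚ (Fin n → ℝ) := span ℚ (Set.range u)
  have hUq : finrank ℚ Uq = k := by rw [finrank_span_eq_card hQ, Fintype.card_fin]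
  have hUW : Uq ≤ W := span_le.mpr (Set.range_subset_iff.mpr hu)
  -- a `ℚ`-complement of `Uq` inside `W`
  obtain ⟨C, hC⟩ := Submodule.exists_isCompl (Uq.comap W.subtype)
  let U' : Submodule ℚ (Fin n → ℝ) := C.map W.subtype
  have hU'fin : finrank ℚ U' + k = n := by
    have h1 : finrank ℚ (Uq.comap W.subtype) = k := by
      rw [LinearEquiv.finrank_eq (Submodule.comapSubtypeEquivOfLe hUW), hUq]
    have h2 := Submodule.finrank_add_eq_of_isCompl hC
    have h3 : finrank ℚ U' = finrank ℚ C :=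
      (LinearEquiv.finrank_eq (Submodule.equivMapOfInjective _ W.injective_subtype C)).symm
    rw [h1, PeriodRank.finrank_ratVectors] at h2
    omega
  -- `W ⊆ Uq ⊔ U'`, hence `ℝⁿ = ℝW ⊆ ℝUq ⊔ ℝU'`
  have hWle : (W : Set (Fin n → ℝ)) ⊆ ((Uq ⊔ U' : Submodule ℚ (Fin n → ℝ)) : Set (Fin n → ℝ)) := by
    intro w hw
    have hmem : (⟨w, hw⟩ : W) ∈ Uq.comap W.subtype ⊔ C := by rw [hC.sup_eq_top]; trivial
    obtain ⟨a, ha, c, hc, hac⟩ := Submodule.mem_sup.mp hmem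
    rw [SetLike.mem_coe, Submodule.mem_sup]
    refine ⟨(a : Fin n → ℝ), ha, (c : Fin n → ℝ), ⟨c, hc, rfl⟩, ?_⟩
    have := congrArg Subtype.val hac
    simpa using this
  have htop : (⊤ : Submodule ℝ (Fin n → ℝ)) ≤
      span ℝ (Uq : Set (Fin n → ℝ)) ⊔ span ℝ (U' : Set (Fin n → ℝ)) := by
    rw [← PeriodRank.span_real_ratVectors n, ← Submodule.span_union]
    have hsup : ((Uq ⊔ U' : Submodule ℚ (Fin n → ℝ)) : Set (Fin n → ℝ)) ⊆
        span ℝ ((Uq : Set (Fin n → ℝ)) ∪ (U' : Set (Fin n → ℝ))) := by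
      rw [← Submodule.span_span_of_tower ℚ ℝ ((Uq : Set (Fin n → ℝ)) ∪ (U' : Set (Fin n → ℝ))), Submodule.span_union,
        Submodule.span_eq, Submodule.span_eq]
      exact Submodule.subset_span
    exact span_le.mpr (hWle.trans hsup)
  have hn : n ≤ finrank ℝ (span ℝ (Uq : Set (Fin n → ℝ))) + finrank ℝ (span ℝ (U' : Set (Fin n → ℝ))) := by
    have h1 := Submodule.finrank_mono htop
    rw [finrank_top, Module.finrank_fin_fun ℝ] at h1
    exact h1.trans (Submodule.finrank_add_le_finrank_add_finrank _ _)
  have hU'ℝ : finrank ℝ (span ℝ (U' : Set (Fin n → ℝ))) ≤ finrank ℚ U' := PeriodRank.finrank_real_span_le_finrank_rat U'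
  have hUqD : span ℝ (Uq : Set (Fin n → ℝ)) ≤ D := by
    rw [Submodule.span_span_of_tower]
    exact span_le.mpr (Set.range_subset_iff.mpr hD)
  have hD' := Submodule.finrank_mono hUqD
  omega

/-! ## §2 The modular lattice: integer coordinates, the coordinate map of the pairing, real extensions -/

section Modular

variable {N : ℕ} [NeZero N]

/-- **Integer coordinates.** If `Λ = H₁(X₀(N);ℤ)` is the `ℤ`-span of a real basis `b` of `S₂(Γ₀(N))^∨` (Eichler–Shimura, the tree's
`periodHomology_eq_span_basis_holds`), every `y ∈ Λ` is `∑ᵢ zᵢ bᵢ` with `zᵢ ∈ ℤ` its `b`-coordinates. [cite: DiamondShurman2005, §6.1] -/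
theorem exists_int_coords {n : ℕ} (b : Module.Basis (Fin n) ℝ (Module.Dual ℂ (CuspForm (Gamma0 N) 2)))
    (hL : (periodHomology N : Set (Module.Dual ℂ (CuspForm (Gamma0 N) 2))) = Submodule.span ℤ (Set.range b))
    (bZ : Fin n → periodHomologyHecke N) (hbZ : ∀ i, (bZ i : Module.Dual ℂ (CuspForm (Gamma0 N) 2)) = b i)
    (y : periodHomologyHecke N) :
    ∃ z : Fin n → ℤ, (∀ i, b.repr (y : Module.Dual ℂ (CuspForm (Gamma0 N) 2)) i = (z i : ℝ)) ∧ y = ∑ i, z i • bZ i := by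
  have hy : (y : Module.Dual ℂ (CuspForm (Gamma0 N) 2)) ∈ Submodule.span ℤ (Set.range b) := by
    rw [← SetLike.mem_coe, ← hL, SetLike.mem_coe]
    exact (mem_periodHomologyHecke N).mp y.2
  choose z hz using fun i ↦ (Module.Basis.mem_span_iff_repr_mem ℤ b _).mp hy i
  have hz' : ∀ i, b.repr (y : Module.Dual ℂ (CuspForm (Gamma0 N) 2)) i = (z i : ℝ) := fun i ↦ by
    rw [← hz i]; simp
  refine ⟨z, hz', Subtype.ext ?_⟩
  rw [Submodule.coe_sum]
  simp only [Submodule.coe_smul_of_tower, hbZ]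
  conv_lhs => rw [← b.sum_repr (y : Module.Dual ℂ (CuspForm (Gamma0 N) 2))]
  refine Finset.sum_congr rfl fun i _ ↦ ?_
  rw [hz' i, Int.cast_smul_eq_zsmul]

/-- **The coordinate map of the pairing.** With `B` bi-additive on `Λ` and `bZ` the Eichler–Shimura `ℤ`-basis of `Λ`: `x ↦ (B(x, bZᵢ))ᵢ ∈ ℤⁿ ⊆ ℝⁿ` is
`ℤ`-linear, and it is INJECTIVE when `x ↦ B(x, ·)` is (perfectness). [cite: DarmonDiamondTaylor1995, §1.6 Lemma 1.38 (p. 41)] -/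
theorem exists_coordMap {n : ℕ} (b : Module.Basis (Fin n) ℝ (Module.Dual ℂ (CuspForm (Gamma0 N) 2)))
    (hL : (periodHomology N : Set (Module.Dual ℂ (CuspForm (Gamma0 N) 2))) = Submodule.span ℤ (Set.range b))
    (bZ : Fin n → periodHomologyHecke N) (hbZ : ∀ i, (bZ i : Module.Dual ℂ (CuspForm (Gamma0 N) 2)) = b i)
    (B : periodHomologyHecke N →+ periodHomologyHecke N →+ ℤ) (hB : Function.Injective B) :
    ∃ Ψ : periodHomologyHecke N →ₗ[ℤ] (Fin n → ℝ), (∀ x i, Ψ x i = ((B x (bZ i) : ℤ) : ℝ)) ∧ LinearMap.ker Ψ = ⊥ := by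
  refine ⟨{ toFun := fun x i ↦ ((B x (bZ i) : ℤ) : ℝ)
            map_add' := fun x y ↦ by
              ext i
              simp only [map_add, AddMonoidHom.add_apply, Int.cast_add, Pi.add_apply]
            map_smul' := fun m x ↦ by
              ext i
              rw [RingHom.id_apply, Pi.smul_apply, ← AddMonoidHom.flip_apply B, map_zsmul, AddMonoidHom.flip_apply, zsmul_eq_mul,
                zsmul_eq_mul, Int.cast_mul, Int.cast_id] }, fun _ _ ↦ rfl, ?_⟩
  rw [LinearMap.ker_eq_bot']
  intro x hx
  have h0 : ∀ i, B x (bZ i) = 0 := fun i ↦ by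
    have := congrFun hx i
    simp only [LinearMap.coe_mk, AddHom.coe_mk, Pi.zero_apply, Int.cast_eq_zero] at this
    exact this
  have hBx : B x = 0 := by
    ext y
    obtain ⟨z, -, hy⟩ := exists_int_coords b hL bZ hbZ y
    rw [hy, map_sum, AddMonoidHom.zero_apply]
    exact Finset.sum_eq_zero fun i _ ↦ by rw [map_zsmul, h0 i, smul_zero]
  exact hB (hBx.trans (map_zero B).symm)

/-- **Real extension of `B(x, ·)`.** The `ℝ`-linear functional on `S₂(Γ₀(N))^∨` with values `B(x, bZᵢ)` on the Eichler–Shimura basis restricts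
to `B(x, ·)` on `Λ`. [cite: DiamondShurman2005, §6.1] -/
theorem exists_realExtension {n : ℕ} (b : Module.Basis (Fin n) ℝ (Module.Dual ℂ (CuspForm (Gamma0 N) 2)))
    (hL : (periodHomology N : Set (Module.Dual ℂ (CuspForm (Gamma0 N) 2))) = Submodule.span ℤ (Set.range b))
    (bZ : Fin n → periodHomologyHecke N) (hbZ : ∀ i, (bZ i : Module.Dual ℂ (CuspForm (Gamma0 N) 2)) = b i)
    (B : periodHomologyHecke N →+ periodHomologyHecke N →+ ℤ) (x : periodHomologyHecke N) :
    ∃ h : Module.Dual ℝ (Module.Dual ℂ (CuspForm (Gamma0 N) 2)),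
      (∀ i, h (b i) = ((B x (bZ i) : ℤ) : ℝ)) ∧
      ∀ y : periodHomologyHecke N, h (y : Module.Dual ℂ (CuspForm (Gamma0 N) 2)) = ((B x y : ℤ) : ℝ) := by
  refine ⟨b.constr ℝ fun i ↦ ((B x (bZ i) : ℤ) : ℝ), fun i ↦ by simp only [Module.Basis.constr_basis], fun y ↦ ?_⟩
  obtain ⟨z, hz, hy⟩ := exists_int_coords b hL bZ hbZ y
  have hyℝ : (y : Module.Dual ℂ (CuspForm (Gamma0 N) 2)) = ∑ i, (z i : ℝ) • b i := by
    conv_lhs => rw [← b.sum_repr (y : Module.Dual ℂ (CuspForm (Gamma0 N) 2))]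
    exact Finset.sum_congr rfl fun i _ ↦ by rw [hz i]
  have hBy : B x y = ∑ i, z i * B x (bZ i) := by
    rw [hy, map_sum]
    exact Finset.sum_congr rfl fun i _ ↦ by rw [map_zsmul, zsmul_eq_mul, Int.cast_id]
  rw [hBy, hyℝ]
  simp only [map_sum, map_smul, Module.Basis.constr_basis, smul_eq_mul, Int.cast_sum, Int.cast_mul]

/-- **The annihilator of the Hecke ranges has real dimension `≤ 2`.** For `f` the newform of a curve `W` (`IsNewformOf W f`) let
`U_I = ∑_{t ∈ I_f} range (t^∨) ⊆ V = S₂(Γ₀(N))^∨` (real subspace; `t^∨ φ = φ ∘ t = t • φ`). Then the real-linear functionals on `V` killing `U_I` form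
a space of dimension `≤ 2`: `U_I ⊇ ∑_p range (T_p − a_p)^∨`, whose complex codimension is `dim ⋂_p ker(T_p − a_p) = 1` (multiplicity one,
`IsNewform0.mem_span_of_forall_heckeT_eq_smul`; finitely many `p` suffice; the tree's `PeriodRank.finrank_dual_quotient_iSup_range_dualMap`).
[cite: CremonaAlgorithms1997, §2.10 (2.10.1)] [cite: Shimura1971, Thm. 7.14] -/
theorem finrank_dualAnnihilator_heckeRanges_le_two {n : ℕ} (b : Module.Basis (Fin n) ℝ (Module.Dual ℂ (CuspForm (Gamma0 N) 2)))
    {W : WeierstrassCurve ℚ} {f : CuspForm (Gamma0 N) 2} (hf : IsNewformOf W f) :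
    finrank ℝ (Submodule.dualAnnihilator
      (⨆ t : heckeAnnihilator f, LinearMap.range ((HeckeRing0.toEnd N 2 (t : HeckeRing0 N 2)).dualMap.restrictScalars ℝ) :
        Submodule ℝ (Module.Dual ℂ (CuspForm (Gamma0 N) 2)))) ≤ 2 := by
  haveI hWfin : Module.Finite ℝ (Module.Dual ℂ (CuspForm (Gamma0 N) 2)) := Module.Finite.of_basis b
  haveI hWfinC : Module.Finite ℂ (Module.Dual ℂ (CuspForm (Gamma0 N) 2)) :=
    Module.Finite.of_restrictScalars_finite ℝ ℂ (Module.Dual ℂ (CuspForm (Gamma0 N) 2))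
  haveI : FiniteDimensional ℂ (CuspForm (Gamma0 N) 2) := (Module.finite_dual_iff ℂ).mp hWfinC
  -- the operators `T_p − a_p`, `a_p = a_p(W) ∈ ℤ`, as Hecke ring elements `t_p ∈ I_f`
  let P := {p : ℕ // p.Prime}
  let a : P → ℤ := fun p ↦ W.LFunction p
  let φ : P → CuspForm (Gamma0 N) 2 →ₗ[ℂ] CuspForm (Gamma0 N) 2 := fun p ↦
    (haveI : NeZero (p : ℕ) := ⟨p.2.ne_zero⟩; heckeT (Gamma0 N) 2 p) - ((a p : ℤ) : ℂ) • LinearMap.id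
  let tt : P → HeckeRing0 N 2 := fun p ↦ HeckeRing0.T N 2 p p.2 - algebraMap ℤ (HeckeRing0 N 2) (a p)
  have htt_end : ∀ p : P, HeckeRing0.toEnd N 2 (tt p) = φ p := by
    intro p
    simp only [tt, φ, map_sub, HeckeRing0.toEnd_T]
    congr 1
    rw [Int.cast_smul_eq_zsmul]
    norm_cast
  have hTf : ∀ p : P, (haveI : NeZero (p : ℕ) := ⟨p.2.ne_zero⟩; heckeT (Gamma0 N) 2 p f) = ((a p : ℤ) : ℂ) • f := by
    intro p
    haveI : NeZero (p : ℕ) := ⟨p.2.ne_zero⟩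
    rw [hf.1.heckeT_eq_coeff_smul p.2]
    change cuspCoeff f p • f = _
    rw [hf.2 p]
  have hφf : ∀ p, φ p f = 0 := fun p ↦ by
    simp only [φ, LinearMap.sub_apply, LinearMap.smul_apply, LinearMap.id_apply, hTf p, sub_self]
  have htt_mem : ∀ p : P, tt p ∈ heckeAnnihilator f := by
    intro p
    show HeckeRing0.toEnd N 2 (tt p) f = 0
    rw [htt_end]
    exact hφf p
  -- multiplicity one: the joint kernel is `ℂ f`
  have hM1 : ∀ h : CuspForm (Gamma0 N) 2, (∀ p : P, φ p h = 0) → h ∈ Submodule.span ℂ ({f} : Set (CuspForm (Gamma0 N) 2)) := by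
    intro h hh
    refine hf.1.mem_span_of_forall_heckeT_eq_smul h fun p hp ↦ ?_
    have h1 := hh ⟨p, hp⟩
    simp only [φ, LinearMap.sub_apply, LinearMap.smul_apply, LinearMap.id_apply, sub_eq_zero] at h1
    rw [h1, heckeEigenvalue_eq_coeff_of_isNormalized hf.1.2.2 hp (hf.1.2.1 p hp)]
    change _ = cuspCoeff f p • h
    rw [hf.2 p]
  have hker_le : (⨅ p, LinearMap.ker (φ p)) ≤ Submodule.span ℂ ({f} : Set (CuspForm (Gamma0 N) 2)) := by
    intro h hh
    rw [Submodule.mem_iInf] at hh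
    exact hM1 h fun p ↦ hh p
  obtain ⟨s, hs⟩ := PeriodRank.exists_finset_iInf_eq fun p ↦ LinearMap.ker (φ p)
  let ψ : ↥s → CuspForm (Gamma0 N) 2 →ₗ[ℂ] CuspForm (Gamma0 N) 2 := fun p ↦ φ p
  have hEq : (⨅ p : ↥s, LinearMap.ker (ψ p)) = Submodule.span ℂ ({f} : Set (CuspForm (Gamma0 N) 2)) := by
    apply le_antisymm
    · have : (⨅ p : ↥s, LinearMap.ker (ψ p)) = ⨅ p ∈ s, LinearMap.ker (φ p) := by rw [iInf_subtype']
      rw [this, ← hs]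
      exact hker_le
    · rw [Submodule.span_singleton_le_iff_mem, Submodule.mem_iInf]
      exact fun p ↦ hφf p
  have hfinE : finrank ℂ (⨅ p : ↥s, LinearMap.ker (ψ p) : Submodule ℂ (CuspForm (Gamma0 N) 2)) = 1 := by
    rw [hEq, finrank_span_singleton hf.1.ne_zero]
  -- `U = ∑_{p ∈ s} range (T_p − a_p)^∨` has complex codimension `1`, real codimension `2`
  let U : Submodule ℂ (Module.Dual ℂ (CuspForm (Gamma0 N) 2)) := ⨆ p : ↥s, LinearMap.range (ψ p).dualMap
  have hUq : finrank ℂ (Module.Dual ℂ (CuspForm (Gamma0 N) 2) ⧸ U) = 1 := by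
    rw [PeriodRank.finrank_dual_quotient_iSup_range_dualMap ψ, hfinE]
  have hUfin : finrank ℂ U + 1 = finrank ℂ (Module.Dual ℂ (CuspForm (Gamma0 N) 2)) := by
    have := Submodule.finrank_quotient_add_finrank U
    omega
  have h2W : finrank ℝ (Module.Dual ℂ (CuspForm (Gamma0 N) 2)) = 2 * finrank ℂ (Module.Dual ℂ (CuspForm (Gamma0 N) 2)) :=
    finrank_real_of_complex _
  have hUℝ : finrank ℝ (U.restrictScalars ℝ) = 2 * finrank ℂ U := by
    let eU : U.restrictScalars ℝ ≃ₗ[ℝ] U :=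
      { toFun := fun x ↦ ⟨x.1, x.2⟩
        invFun := fun x ↦ ⟨x.1, x.2⟩
        map_add' := fun _ _ ↦ rfl
        map_smul' := fun _ _ ↦ rfl
        left_inv := fun _ ↦ rfl
        right_inv := fun _ ↦ rfl }
    rw [eU.finrank_eq, finrank_real_of_complex U]
  -- `U ⊆ U_I`
  have hle : U.restrictScalars ℝ ≤
      ⨆ t : heckeAnnihilator f, LinearMap.range ((HeckeRing0.toEnd N 2 (t : HeckeRing0 N 2)).dualMap.restrictScalars ℝ) := by
    intro w hw
    change w ∈ U at hw
    induction hw using Submodule.iSup_induction' with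
    | mem p y hy =>
      obtain ⟨x, rfl⟩ := hy
      refine Submodule.mem_iSup_of_mem ⟨tt (p : P), htt_mem (p : P)⟩ ⟨x, ?_⟩
      rw [LinearMap.restrictScalars_apply, htt_end]
    | zero => exact Submodule.zero_mem _
    | add y y' _ _ hy hy' => exact Submodule.add_mem _ hy hy'
  have hmono := Submodule.finrank_mono hle
  have hA := Subspace.finrank_add_finrank_dualAnnihilator_eq
    (⨆ t : heckeAnnihilator f, LinearMap.range ((HeckeRing0.toEnd N 2 (t : HeckeRing0 N 2)).dualMap.restrictScalars ℝ) :
      Submodule ℝ (Module.Dual ℂ (CuspForm (Gamma0 N) 2)))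
  omega

/-! ## §3 The rank bound -/

/-- **RANK2 (upper half): `Λ[I_f]` has `ℤ`-rank at most `2`.** For `f` the newform of an elliptic curve `W/ℚ` (`IsNewformOf W f`, so that all
Hecke eigenvalues are integers) and any `ℤ`-linearly independent family `v₁,…,v_k` in `Λ = H₁(X₀(N);ℤ)` (`periodHomologyHecke N`) killed by the Hecke
annihilator `I_f` of `f`: `k ≤ 2`. See the module docstring for the mechanism (perfect Hecke-self-adjoint pairing ⟹ `Λ[I_f] ↪` annihilator of
`∑_p range(T_p − a_p)^∨`, of real dimension `≤ 2` by multiplicity one and Eichler–Shimura). [cite: DarmonDiamondTaylor1995, §1.6 Lemma 1.38 and §1.7]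
[cite: CremonaAlgorithms1997, §2.8 and §2.10] [cite: Shimura1971, Thm. 7.14] -/
theorem card_le_two_of_linearIndependent_of_isotypic
    {W : WeierstrassCurve ℚ} {f : CuspForm (Gamma0 N) 2} (hf : IsNewformOf W f)
    {k : ℕ} (v : Fin k → periodHomologyHecke N) (hv : LinearIndependent ℤ v)
    (hiso : ∀ j, ∀ t ∈ heckeAnnihilator f, t • v j = 0) : k ≤ 2 := by
  -- the pairing and the Eichler–Shimura basis
  obtain ⟨B, hB, hadj⟩ := ip_of_crossingPairing_flagSides N
  obtain ⟨n, b, hL⟩ := periodHomology_eq_span_basis_holds N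
  have hbmem : ∀ i, b i ∈ periodHomologyHecke N := fun i ↦ by
    rw [mem_periodHomologyHecke, ← SetLike.mem_coe, hL, SetLike.mem_coe]
    exact Submodule.subset_span ⟨i, rfl⟩
  obtain ⟨bZ, hbZ⟩ : ∃ bZ : Fin n → periodHomologyHecke N, ∀ i, (bZ i : Module.Dual ℂ (CuspForm (Gamma0 N) 2)) = b i :=
    ⟨fun i ↦ ⟨b i, hbmem i⟩, fun _ ↦ rfl⟩
  -- the injective coordinate map `Ψ x = (B(x, bZᵢ))ᵢ` and the independent rational vectors `u = Ψ ∘ v`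
  obtain ⟨Ψ, hΨ, hΨker⟩ := exists_coordMap b hL bZ hbZ B hB.1
  obtain ⟨u, hu_def⟩ : ∃ u : Fin k → (Fin n → ℝ), ∀ j, u j = Ψ (v j) := ⟨_, fun _ ↦ rfl⟩
  have hu_li : LinearIndependent ℤ u := by
    have hu : u = Ψ ∘ v := funext hu_def
    rw [hu]
    exact hv.map' Ψ hΨker
  have hu_rat : ∀ j, u j ∈ PeriodRank.ratVectors n := fun j ↦ by
    rw [PeriodRank.mem_ratVectors_iff]
    intro i
    refine ⟨(B (v j) (bZ i) : ℚ), ?_⟩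
    show ((B (v j) (bZ i) : ℚ) : ℝ) = u j i
    rw [hu_def, hΨ, Rat.cast_intCast]
  -- the real subspace `D ⊆ ℝⁿ`: dual-basis coordinates of the annihilator of the Hecke ranges, `dim D ≤ 2`
  haveI hWfin : Module.Finite ℝ (Module.Dual ℂ (CuspForm (Gamma0 N) 2)) := Module.Finite.of_basis b
  obtain ⟨eStar, heStar⟩ : ∃ e : Module.Dual ℝ (Module.Dual ℂ (CuspForm (Gamma0 N) 2)) ≃ₗ[ℝ] (Fin n → ℝ),
      ∀ l i, e l i = l (b i) :=
    ⟨b.dualBasis.equivFun, fun l i ↦ Module.Basis.dualBasis_equivFun b l i⟩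
  obtain ⟨A, hA_def⟩ : ∃ A : Submodule ℝ (Module.Dual ℝ (Module.Dual ℂ (CuspForm (Gamma0 N) 2))),
      A = Submodule.dualAnnihilator
        (⨆ t : heckeAnnihilator f, LinearMap.range ((HeckeRing0.toEnd N 2 (t : HeckeRing0 N 2)).dualMap.restrictScalars ℝ) :
          Submodule ℝ (Module.Dual ℂ (CuspForm (Gamma0 N) 2))) := ⟨_, rfl⟩
  have hA2 : finrank ℝ A ≤ 2 := by
    rw [hA_def]
    exact finrank_dualAnnihilator_heckeRanges_le_two b hf
  obtain ⟨D, hD_def⟩ : ∃ D : Submodule ℝ (Fin n → ℝ), D = A.map eStar.toLinearMap := ⟨_, rfl⟩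
  have hD2 : finrank ℝ D ≤ 2 := by
    rw [hD_def, LinearEquiv.finrank_map_eq]
    exact hA2
  -- each `u j` lies in `D`: the real extension of `B(v j, ·)` kills every `t • x`, `t ∈ I_f` (self-adjointness)
  have hmemD : ∀ j, u j ∈ D := by
    intro j
    obtain ⟨h, hhb, hhΛ⟩ := exists_realExtension b hL bZ hbZ B (v j)
    have hkill : h ∈ A := by
      rw [hA_def, Submodule.mem_dualAnnihilator]
      intro w hw
      induction hw using Submodule.iSup_induction' with
      | mem t y hy =>
        obtain ⟨x, rfl⟩ := hy
        -- `x ↦ h (t • x)` is `ℝ`-linear and vanishes on the basis `b`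
        have hzero : ((HeckeRing0.toEnd N 2 (t : HeckeRing0 N 2)).dualMap.restrictScalars ℝ).dualMap h = 0 := by
          refine b.ext fun i ↦ ?_
          rw [LinearMap.dualMap_apply, LinearMap.restrictScalars_apply, LinearMap.zero_apply]
          have hmem : (HeckeRing0.toEnd N 2 (t : HeckeRing0 N 2)).dualMap (b i) =
              (((t : HeckeRing0 N 2) • bZ i : periodHomologyHecke N) : Module.Dual ℂ (CuspForm (Gamma0 N) 2)) := by
            rw [Submodule.coe_smul, hbZ]
            ext g
            rw [LinearMap.dualMap_apply, HeckeRing0.smul_dual_apply]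
          rw [hmem, hhΛ, ← hadj, hiso j _ t.2, map_zero, AddMonoidHom.zero_apply, Int.cast_zero]
        have := congrArg (fun L : Module.Dual ℝ (Module.Dual ℂ (CuspForm (Gamma0 N) 2)) ↦ L x) hzero
        simpa only [LinearMap.dualMap_apply, LinearMap.zero_apply] using this
      | zero => exact map_zero h
      | add y y' _ _ hy hy' => rw [map_add, hy, hy', add_zero]
    rw [hD_def, Submodule.mem_map]
    refine ⟨h, hkill, ?_⟩
    ext i
    rw [LinearEquiv.coe_coe, heStar, hhb i, hu_def, hΨ]
  -- conclude by §1
  have := card_le_finrank_of_linearIndependent_int u hu_rat hu_li D hmemD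
  omega

/-! ## §4 Corollaries in the consumers' currencies -/

/-- **`finrank_ℤ Λ[I_f] ≤ 2`** for the `I_f`-torsion submodule `Λ[I_f] = Submodule.torsionBySet 𝕋_ℤ Λ I_f` of `Λ = periodHomologyHecke N`
(as a `ℤ`-module by restriction of scalars). [cite: DarmonDiamondTaylor1995, §1.6–§1.7] [cite: CremonaAlgorithms1997, §2.8] -/
theorem finrank_isotypic_le_two {W : WeierstrassCurve ℚ} {f : CuspForm (Gamma0 N) 2} (hf : IsNewformOf W f) :
    Module.finrank ℤ ((Submodule.torsionBySet (HeckeRing0 N 2) (periodHomologyHecke N)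
      (heckeAnnihilator f : Set (HeckeRing0 N 2))).restrictScalars ℤ) ≤ 2 := by
  set T := (Submodule.torsionBySet (HeckeRing0 N 2) (periodHomologyHecke N)
      (heckeAnnihilator f : Set (HeckeRing0 N 2))).restrictScalars ℤ with hT
  have hTmem : ∀ y : periodHomologyHecke N, y ∈ T ↔ ∀ t ∈ heckeAnnihilator f, t • y = 0 := fun y ↦ by
    rw [hT, Submodule.restrictScalars_mem, Submodule.mem_torsionBySet_iff]
    simp only [Subtype.forall, SetLike.mem_coe]
  by_contra hlt
  have h3 : 3 ≤ Module.finrank ℤ T := by omega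
  obtain ⟨w, hw⟩ := exists_linearIndependent_of_le_finrank h3
  -- a `ℤ`-independent family of size `3` in `Λ[I_f]`
  let v : Fin 3 → periodHomologyHecke N := fun j ↦ (w j : periodHomologyHecke N)
  have hv : LinearIndependent ℤ v := hw.map' T.subtype (Submodule.ker_subtype T)
  have hiso : ∀ j, ∀ t ∈ heckeAnnihilator f, t • v j = 0 := fun j ↦ (hTmem _).mp (w j).2
  have hk := card_le_two_of_linearIndependent_of_isotypic hf v hv hiso
  omega

end Modular

end Summit.BirchSwinnertonDyer.BirchSwinnertonDyer.Theorems.AlignedTransportAtTwoKilfordCopyRankTwo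

end
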